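import Literature.NumberTheory.EllipticCurves.IsogenyRealPeriodProofs
import HarnessLib

/-!
# The multiplier of an isogeny: archimedean local factor and coordinate identity on `E(K̄)`

Topic `NumberTheory/EllipticCurves`; a proofs-only file (theorems only: no definitions, no named
facts).  A repackaging, for the use of the `p`-adic files of step (V) of the proof of Milne,
*Arithmetic Duality Theorems*, Thm. I.7.3 (`IsogenyPadicLinearTermProofs`,
`IsogenyPadicLocalFactorProofs`), of the tree's
`WeierstrassCurve.Isogeny.exists_algebraMap_card_ker_inf_realPoints_mul_realPeriod_eq`
(`IsogenyRealPeriodProofs`): for an isogeny `ψ : E → E'` of elliptic curves over a field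
`K ⊆ ℝ` there is `k ∈ K`, `k ≠ 0` — the multiplier of `ψ` on invariant differentials,
`ψ^*ω' = k ω` — such that

* (archimedean local factor, Milne p. 98 at `v = ∞`)
  `#ker(ψ_ℂ|E(ℝ)) · Ω(E') = [E'(ℝ) : ψ_ℂ E(ℝ)] · |k| · Ω(E)`;
* (coordinate identity **on `E(K̄)`**) for every rational representation
  `ρ = (P₁/Q₁, P₂/Q₂)` of `ψ` and every affine `(x, y) ∈ E(K̄)`,
  `k · (Q₁(2P₂Q₁² + a₁'P₁Q₁Q₂ + a₃'Q₁²Q₂))(x, y) = (Q₁Q₂(δP₁·Q₁ - P₁·δQ₁))(x, y)`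
  (`δ = d/ω`, `WeierstrassCurve.invariantDerivation`).

The source states the coordinate identity at the complex points and under a choice of period
lattices and uniformizations; here the lattices and uniformizations are supplied
(`exists_periodPair_realPeriod_eq_holds`, `PeriodPair.exists_addMonoidHom_of_g₂_g₃`) and the
identity is pulled back along the injection `K̄ → ℂ`
(`WeierstrassCurve.Isogeny.exists_multiplier`, using the tree's `eval_map_algebraMap_vec₂`).  This is the form in which the SAME `k` enters
the non-archimedean local factors `z(ψ(ℚ_p)) = |k|_p c_p #Ẽ_ns/(c'_p #Ẽ'_ns)` (Milne, p. 98;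
for `K = ℚ`, `∏_v |k|_v = 1`).

## References

* J. S. Milne, *Arithmetic Duality Theorems*, 2nd ed. (2006), Ch. I §7, proof of Thm. 7.3, p. 98.
  [MilneADT2006]
* J. H. Silverman, *The Arithmetic of Elliptic Curves*, 2nd ed., GTM 106 (2009), III.5, VI.4.
  [SilvermanAEC2009]
-/

noncomputable section

open scoped Classical
open MvPolynomial Complex

namespace WeierstrassCurve

open PeriodPair Literature.NumberTheory.EllipticCurves

universe u

variable {K : Type u} [Field K] [Algebra K ℝ] [Algebra K ℂ] [IsScalarTower K ℝ ℂ]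
  [Algebra (AlgebraicClosure K) ℂ] [IsScalarTower K (AlgebraicClosure K) ℂ]

/-- **The multiplier of an isogeny** (Milne, *ADT* I.7, proof of Thm. 7.3, p. 98; Silverman,
*AEC*, III.5): for an isogeny `ψ : E → E'` over `K ⊆ ℝ` there is `k ∈ K`, `k ≠ 0`, with
(i) `#ker(ψ_ℂ|E(ℝ)) · Ω(E') = [E'(ℝ) : ψ_ℂ E(ℝ)] · |k| · Ω(E)` (the archimedean local factor
`z(ψ(ℝ)) = |k| Ω(E)/Ω(E')`) and (ii) the coordinate identity `ψ^*ω' = k ω` on `E(K̄)`: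
`k · (Q₁(2P₂Q₁² + a₁'P₁Q₁Q₂ + a₃'Q₁²Q₂))(x, y) = (Q₁Q₂(δP₁·Q₁ - P₁·δQ₁))(x, y)` for every
rational representation `(P₁/Q₁, P₂/Q₂)` of `ψ` and every affine `(x, y) ∈ E(K̄)`.
[cite: MilneADT2006, Ch. I §7, proof of Thm. 7.3, p. 98] -/
theorem Isogeny.exists_multiplier {W W' : WeierstrassCurve K} [W.IsElliptic] [W'.IsElliptic]
    (ψ : Isogeny W W') :
    ∃ k : K, k ≠ 0 ∧
      (Nat.card ↥((ψ.baseChange (M := ℂ)).ker ⊓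
          (Affine.Point.map (W' := W) (IsScalarTower.toAlgHom K ℝ ℂ)).range) : ℝ) *
          (W'.baseChange ℝ).realPeriod =
        (((Affine.Point.map (W' := W) (IsScalarTower.toAlgHom K ℝ ℂ)).range.map
            (ψ.baseChange (M := ℂ))).relIndex
            (Affine.Point.map (W' := W') (IsScalarTower.toAlgHom K ℝ ℂ)).range : ℝ) *
          |algebraMap K ℝ k| * (W.baseChange ℝ).realPeriod ∧
      ∀ (ρ : RatRep W W' ψ) (x y : AlgebraicClosure K),
        (W.baseChange (AlgebraicClosure K)).toAffine.Nonsingular x y →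
          algebraMap K (AlgebraicClosure K) k * MvPolynomial.eval ![x, y]
            (ρ.Q₁ * (C 2 * ρ.P₂ * ρ.Q₁ ^ 2 +
              C (W'.baseChange (AlgebraicClosure K)).a₁ * ρ.P₁ * ρ.Q₁ * ρ.Q₂ +
              C (W'.baseChange (AlgebraicClosure K)).a₃ * ρ.Q₁ ^ 2 * ρ.Q₂)) =
          MvPolynomial.eval ![x, y] (ρ.Q₁ * ρ.Q₂ *
            ((W.baseChange (AlgebraicClosure K)).invariantDerivation ρ.P₁ * ρ.Q₁ -
              ρ.P₁ * (W.baseChange (AlgebraicClosure K)).invariantDerivation ρ.Q₁)) := by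
  obtain ⟨k, hk0, hperiod, hall⟩ := ψ.exists_algebraMap_card_ker_inf_realPoints_mul_realPeriod_eq
  refine ⟨k, hk0, hperiod, fun ρ x₀ y₀ h₀ => ?_⟩
  -- period lattices and uniformizations of the two models, to unlock the coordinate identity
  haveI hWℝ : (W.baseChange ℝ).IsElliptic := by rw [WeierstrassCurve.baseChange]; infer_instance
  haveI hWℝ' : (W'.baseChange ℝ).IsElliptic := by rw [WeierstrassCurve.baseChange]; infer_instance
  have hc₄ : (((W.baseChange ℝ).c₄ : ℝ) : ℂ) = (W.baseChange ℂ).c₄ := by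
    rw [WeierstrassCurve.baseChange, WeierstrassCurve.baseChange, map_c₄, map_c₄,
      ofReal_algebraMap_eq]
  have hc₆ : (((W.baseChange ℝ).c₆ : ℝ) : ℂ) = (W.baseChange ℂ).c₆ := by
    rw [WeierstrassCurve.baseChange, WeierstrassCurve.baseChange, map_c₆, map_c₆,
      ofReal_algebraMap_eq]
  have hc₄' : (((W'.baseChange ℝ).c₄ : ℝ) : ℂ) = (W'.baseChange ℂ).c₄ := by
    rw [WeierstrassCurve.baseChange, WeierstrassCurve.baseChange, map_c₄, map_c₄,
      ofReal_algebraMap_eq]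
  have hc₆' : (((W'.baseChange ℝ).c₆ : ℝ) : ℂ) = (W'.baseChange ℂ).c₆ := by
    rw [WeierstrassCurve.baseChange, WeierstrassCurve.baseChange, map_c₆, map_c₆,
      ofReal_algebraMap_eq]
  obtain ⟨L, hL₂, hL₃, -⟩ := (W.baseChange ℝ).exists_periodPair_realPeriod_eq_holds
  obtain ⟨L', hL₂', hL₃', -⟩ := (W'.baseChange ℝ).exists_periodPair_realPeriod_eq_holds
  have h₂ : L.g₂ = (W.baseChange ℂ).c₄ / 12 := by rw [hL₂, ← hc₄]; push_cast; ring
  have h₃ : L.g₃ = (W.baseChange ℂ).c₆ / 216 := by rw [hL₃, ← hc₆]; push_cast; ring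
  have h₂' : L'.g₂ = (W'.baseChange ℂ).c₄ / 12 := by rw [hL₂', ← hc₄']; push_cast; ring
  have h₃' : L'.g₃ = (W'.baseChange ℂ).c₆ / 216 := by rw [hL₃', ← hc₆']; push_cast; ring
  obtain ⟨u, hker, -, hu⟩ := exists_addMonoidHom_of_g₂_g₃ (toPoint_add_holds L) h₂ h₃
  obtain ⟨u', hker', -, hu'⟩ := exists_addMonoidHom_of_g₂_g₃ (toPoint_add_holds L') h₂' h₃'
  obtain ⟨-, -, hcoordℂ⟩ := hall h₂ h₃ h₂' h₃' u hker hu u' hker' hu'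
  -- the identity at the complex point `(ι x₀, ι y₀)` and its pull-back along `ι : K̄ → ℂ`
  set ι := algebraMap (AlgebraicClosure K) ℂ with hι
  have hns : (W.baseChange ℂ).toAffine.Nonsingular (ι x₀) (ι y₀) :=
    (Affine.baseChange_nonsingular W
      (IsScalarTower.toAlgHom K (AlgebraicClosure K) ℂ).injective x₀ y₀).mpr h₀
  have h := hcoordℂ ρ (ι x₀) (ι y₀) hns
  rw [eval_map_algebraMap_vec₂, eval_map_algebraMap_vec₂,
    IsScalarTower.algebraMap_apply K (AlgebraicClosure K) ℂ k, ← hι, ← map_mul] at h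
  exact (algebraMap (AlgebraicClosure K) ℂ).injective h

end WeierstrassCurve
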